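import Literature.Geometry.Lorentzian.FinalEraPackage2
import Literature.Geometry.Lorentzian.CausalityPushUp
import Literature.Geometry.Lorentzian.CausalFutureProofs
import HarnessLib

/-!
# Stub H_exh `stub_exhaustion` — region identity and Statement-shaped exhaustion of a normalised final era
# (crux `DispersingCapture`, stmt-FinalStateConjecture-17643, line `registered`, skeleton r11; lead prover c6, 2026-08-17)

Route `DissipativeFinalMotions` of the summit `FinalStateConjecture`. The causal bookkeeping of the bridge
"package + (NDF) + (NL) ⇒ rest-frame settled data" (`Cruxes/DispersingCapture/Lines/registered-c6.md` §2). Given the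
chart-level data of a normalised era — the flat chart `Ψ₀` on `U₀` and the hole charts `Ψᵢ`, late charts into the region
`O` after `T`; the package's region identity (O) and exhaustion (EX); radii `Rᵢ ≥ 2ρ₀`; step data `(t, ρl, τ')` with the
BAND LOCALISATION (a flat point of flat time `> t m` within `ρl m` of `ξᵢ` is `Ψᵢ x` with `τ' m < x⁰`, `r(x) ≤ C₂ρl m + C₁`),
the NO-LEAD clause and the radius catch-up `C₂ρl m + C₁ ≤ Rᵢ` after `τ' m`; the depth floor (NDF); the CERTIFIED HOVER of
a zone point of radius `∈ [100Mᵢ, C₂ρl m + C₁]` and time `∈ (τ' m, τ₁]` into `J⁻` of the truncated slab at `τ₁`; and the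
thinned domain `U₀ ⊓ W` (two-step windows beyond the levels) with its flat chart `Φ₀ = Ψ₀|` — we prove:

* (O1) `O = J⁺(ι X) ∩ I⁻(Φ₀(late t₀) ∪ ⋃ᵢ Ψᵢ(late t₀))` (restart of the region identity at `T₁ := t 0`);
* (S6) for every `τ₁ > t 0`, every point of `O` neither in `Φ₀({t > τ₁})` nor in a growing zone
  `Ψᵢ({t* > τ₁, r ≤ Rᵢ(t*)})` lies in `J⁻(Φ₀({t = τ₁}) ∪ ⋃ᵢ Ψᵢ({t* = τ₁, r ≤ Rᵢ(τ₁)}))`.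

Proof (§2 of the note). BAND: a flat point off `W` after `t 0` sits in a two-step window `(t m, t (m+2))` within `ρl m` of
some `ξᵢ`, so the band localisation makes it `Ψᵢ x` with `τ' m < x⁰`, `100Mᵢ ≤ r(x) ≤ C₂ρl m + C₁` ((NDF)) and `x⁰ ≤` its
flat time (no-lead). GENERATORS: every point of the package's certified slab at `τ₁` — a `2ρ₀`-slab point, or a flat-slab
point, which is in `Φ₀`'s slab or (BAND, `x⁰ ≤ τ₁`) hovers — lies in `J⁻` of the Statement-shaped slab. (S6): a tube-late
point is certified; a flat-late point is in `Φ₀`'s late image or (BAND) certified (`x⁰ > τ₁`) or hovers (`x⁰ ≤ τ₁`); any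
other point is package-non-exempt, so (EX) at the same level, GENERATORS and `J⁻J⁻ = J⁻`
(`causalFuture_causalFuture_eq`). (O1): every point of the package's charted region at `T` is, at a level above its unique
late flat time (injectivity of `Ψ₀` on its late region), either tube-late (hence charted after `t 0`) or sent by (EX) +
GENERATORS below a Statement-shaped slab after `t 0`; push-up `I⁻J⁻ = I⁻`
(`chronologicalFuture_causalFuture_eq_of_boundaryless`) and monotonicity of `I⁻` give the identity.

References: O'Neill 1983, Ch. 14, p. 402 (transitivity), Cor. 14.1 (push-up); Dafermos–Luk arXiv:1710.01722, Conj. 1.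
-/

set_option linter.dupNamespace false

noncomputable section

open scoped Manifold ContDiff Topology
open Filter Set Function MeasureTheory Literature.Geometry.Lorentzian

namespace Summit.FinalStateConjecture.FinalStateConjecture.Theorems.DissipativeFinalMotions.DispersingCapture

/-- **H_exh — region identity (O1) and Statement-shaped exhaustion (S6) of a normalised final era** (see the module
docstring for the hypotheses and the proof). O'Neill 1983, Ch. 14, p. 402 and Cor. 14.1. -/
theorem stub_exhaustion : open scoped Manifold Topology in ∀ (X : Type) [TopologicalSpace X] [ChartedSpace (EuclideanSpace ℝ (Fin 3)) X] [IsManifold (𝓡 3) ((⊤ : ℕ∞) : WithTop ℕ∞) X] [T2Space X] [SecondCountableTopology X] [ConnectedSpace X], ∀ (D : Literature.Geometry.Lorentzian.InitialDataSet (𝓡 3) X) (𝒟 : Literature.Geometry.Lorentzian.VacuumCauchyDevelopment D) (N : ℕ) (M a : Fin N → ℝ) (T C₁ C₂ ρ₀ : ℝ) (ξ : Fin N → ℝ → EuclideanSpace ℝ (Fin 3)) (U₀ W : TopologicalSpace.Opens Literature.Geometry.Lorentzian.E4) (Ψ₀ : (Literature.Geometry.Lorentzian.Minkowski.backgroundOn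 U₀).domain → 𝒟.carrier) (Ψ : (i : Fin N) → (Literature.Geometry.Lorentzian.Kerr.background (M i) (a i)).domain → 𝒟.carrier) (O : Set 𝒟.carrier) (R : Fin N → ℝ → ℝ) (t ρl τ' : ℕ → ℝ) (Φ₀ : (Literature.Geometry.Lorentzian.Minkowski.backgroundOn (U₀ ⊓ W)).domain → 𝒟.carrier),
    O = 𝒟.metric.causalFuture 𝒟.timeOrientation (Set.range 𝒟.embed) ∩ 𝒟.metric.chronologicalPast 𝒟.timeOrientation (Ψ₀ '' (Literature.Geometry.Lorentzian.Minkowski.backgroundOn U₀).lateRegion T ∪ ⋃ i, Ψ i '' (Literature.Geometry.Lorentzian.Kerr.background (M i) (a i)).lateRegion T) →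
    𝒟.toSpacetime.IsLateChart (Literature.Geometry.Lorentzian.Minkowski.backgroundOn U₀) O T Ψ₀ →
    (∀ i, 𝒟.toSpacetime.IsLateChart (Literature.Geometry.Lorentzian.Kerr.background (M i) (a i)) O T (Ψ i)) →
    (∀ τ₁, T < τ₁ → O \ (Ψ₀ '' (Literature.Geometry.Lorentzian.Minkowski.backgroundOn U₀).lateRegion τ₁ ∪ ⋃ i, Ψ i '' (Literature.Geometry.Lorentzian.Kerr.background (M i) (a i)).truncLateRegion τ₁ (2 * ρ₀)) ⊆ 𝒟.toSpacetime.metric.causalPast 𝒟.toSpacetime.timeOrientation (Ψ₀ '' (Literature.Geometry.Lorentzian.Minkowski.backgroundOn U₀).timeSlab τ₁ ∪ ⋃ i, Ψ i '' (Literature.Geometry.Lorentzian.Kerr.background (M i) (a i)).truncTimeSlab (2 * ρ₀) τ₁)) →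
    (∀ i τ, 2 * ρ₀ ≤ R i τ) →
    StrictMono t → (∀ m : ℕ, (m : ℝ) ≤ t m) → (∀ m : ℕ, T < t m) → (∀ m : ℕ, T ≤ τ' m) →
    (∀ m i (y : (Literature.Geometry.Lorentzian.Minkowski.backgroundOn U₀).domain), t m < y.1 0 → ‖Literature.Geometry.Lorentzian.E4.spatial y.1 - ξ i (y.1 0)‖ ≤ ρl m → ∃ x : (Literature.Geometry.Lorentzian.Kerr.background (M i) (a i)).domain, Ψ i x = Ψ₀ y ∧ τ' m < x.1 0 ∧ Literature.Geometry.Lorentzian.Kerr.radius (a i) x.1 ≤ C₂ * ρl m + C₁) →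
    (∀ m i (x : (Literature.Geometry.Lorentzian.Kerr.background (M i) (a i)).domain) (y : (Literature.Geometry.Lorentzian.Minkowski.backgroundOn U₀).domain), τ' m ≤ x.1 0 → Literature.Geometry.Lorentzian.Kerr.radius (a i) x.1 ≤ C₂ * ρl m + C₁ → Ψ i x = Ψ₀ y → x.1 0 ≤ y.1 0) →
    (∀ m i τ, τ' m ≤ τ → C₂ * ρl m + C₁ ≤ R i τ) →
    (∀ i (x : (Literature.Geometry.Lorentzian.Kerr.background (M i) (a i)).domain) (y : (Literature.Geometry.Lorentzian.Minkowski.backgroundOn U₀).domain), T < x.1 0 → Ψ i x = Ψ₀ y → 100 * M i ≤ Literature.Geometry.Lorentzian.Kerr.radius (a i) x.1) →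
    (∀ m i (x : (Literature.Geometry.Lorentzian.Kerr.background (M i) (a i)).domain) (τ₁ : ℝ), τ' m < x.1 0 → x.1 0 ≤ τ₁ → 100 * M i ≤ Literature.Geometry.Lorentzian.Kerr.radius (a i) x.1 → Literature.Geometry.Lorentzian.Kerr.radius (a i) x.1 ≤ C₂ * ρl m + C₁ → Ψ i x ∈ 𝒟.toSpacetime.metric.causalPast 𝒟.toSpacetime.timeOrientation (Ψ i '' (Literature.Geometry.Lorentzian.Kerr.background (M i) (a i)).truncTimeSlab (R i τ₁) τ₁)) →
    (∀ y : Literature.Geometry.Lorentzian.E4, y ∈ W → ∃ m : ℕ, t m < y 0 ∧ y 0 < t (m + 2) ∧ ∀ i, ρl m < ‖Literature.Geometry.Lorentzian.E4.spatial y - ξ i (y 0)‖) →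
    (∀ (y : Literature.Geometry.Lorentzian.E4) (m : ℕ), t m < y 0 → y 0 < t (m + 2) → (∀ i, ρl m < ‖Literature.Geometry.Lorentzian.E4.spatial y - ξ i (y 0)‖) → y ∈ W) →
    (∀ y : (Literature.Geometry.Lorentzian.Minkowski.backgroundOn (U₀ ⊓ W)).domain, Φ₀ y = Ψ₀ ⟨y.1, y.2.1⟩) →
    O = 𝒟.metric.causalFuture 𝒟.timeOrientation (Set.range 𝒟.embed) ∩ 𝒟.metric.chronologicalPast 𝒟.timeOrientation (Φ₀ '' (Literature.Geometry.Lorentzian.Minkowski.backgroundOn (U₀ ⊓ W)).lateRegion (t 0) ∪ ⋃ i, Ψ i '' (Literature.Geometry.Lorentzian.Kerr.background (M i) (a i)).lateRegion (t 0)) ∧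
    (∀ τ₁, t 0 < τ₁ → O \ (Φ₀ '' (Literature.Geometry.Lorentzian.Minkowski.backgroundOn (U₀ ⊓ W)).lateRegion τ₁ ∪ ⋃ i, Ψ i '' {x : (Literature.Geometry.Lorentzian.Kerr.background (M i) (a i)).domain | τ₁ < (Literature.Geometry.Lorentzian.Kerr.background (M i) (a i)).time x.1 ∧ (Literature.Geometry.Lorentzian.Kerr.background (M i) (a i)).radius x.1 ≤ R i ((Literature.Geometry.Lorentzian.Kerr.background (M i) (a i)).time x.1)}) ⊆ 𝒟.toSpacetime.metric.causalPast 𝒟.toSpacetime.timeOrientation (Φ₀ '' (Literature.Geometry.Lorentzian.Minkowski.backgroundOn (U₀ ⊓ W)).timeSlab τ₁ ∪ ⋃ i, Ψ i '' (Literature.Geometry.Lorentzian.Kerr.background (M i) (a i)).truncTimeSlab (R i τ₁) τ₁)) := by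
  intro X _ _ _ _ _ _ D 𝒟 N M a T C₁ C₂ ρ₀ ξ U₀ W Ψ₀ Ψ O R t ρl τ' Φ₀ hO hΨ₀ hΨ hEX hR2 ht_mono ht_ge hTt hτ'T hloc
    hnl hRτ hndf hHov hW1 hW2 hΦval
  classical
  -- causal bookkeeping on the (boundaryless) development: monotonicity, `S ⊆ J⁻ S`, `J⁻J⁻ = J⁻`, push-up
  have hJmono : ∀ {S S' : Set 𝒟.carrier}, S ⊆ S' →
      𝒟.toSpacetime.metric.causalPast 𝒟.toSpacetime.timeOrientation S ⊆
        𝒟.toSpacetime.metric.causalPast 𝒟.toSpacetime.timeOrientation S' := fun h ↦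
    LorentzianMetric.causalFuture_mono (τ := 𝒟.timeOrientation.reverse) h
  have hsubJ : ∀ S : Set 𝒟.carrier,
      S ⊆ 𝒟.toSpacetime.metric.causalPast 𝒟.toSpacetime.timeOrientation S := fun S ↦
    LorentzianMetric.subset_causalPast 𝒟.metric 𝒟.timeOrientation S
  have hJJ : ∀ S : Set 𝒟.carrier,
      𝒟.toSpacetime.metric.causalPast 𝒟.toSpacetime.timeOrientation
          (𝒟.toSpacetime.metric.causalPast 𝒟.toSpacetime.timeOrientation S) =
        𝒟.toSpacetime.metric.causalPast 𝒟.toSpacetime.timeOrientation S := fun S ↦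
    LorentzianMetric.causalFuture_causalFuture_eq (τ := 𝒟.timeOrientation.reverse)
      (WithTop.coe_le_coe.2 le_top) S
  -- the index of the last step `≤ s`
  set idx : ℝ → ℕ := fun s ↦ Nat.findGreatest (fun m ↦ t m ≤ s) ⌈s⌉₊ with hidx
  have hidx_ge : ∀ (m : ℕ) (s : ℝ), t m ≤ s → m ≤ idx s := by
    intro m s hs
    have hm : m ≤ ⌈s⌉₊ := Nat.cast_le.1 (((ht_ge m).trans hs).trans (Nat.le_ceil s))
    exact Nat.le_findGreatest hm hs
  have hidx_spec : ∀ s : ℝ, t 0 ≤ s → t (idx s) ≤ s := fun s hs ↦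
    Nat.findGreatest_spec (P := fun m ↦ t m ≤ s) (Nat.zero_le _) hs
  have hidx_lt : ∀ s : ℝ, s < t (idx s + 1) := by
    intro s
    by_contra h
    push Not at h
    exact Nat.lt_irrefl _ (Nat.lt_of_succ_le (hidx_ge _ s h))
  -- a two-step window around every time after `t 0`
  have hwindow : ∀ s : ℝ, t 0 < s → ∃ m : ℕ, t m < s ∧ s < t (m + 2) := by
    intro s hs
    rcases (hidx_spec s hs.le).lt_or_eq with hlt | heq
    · exact ⟨idx s, hlt, (hidx_lt s).trans (ht_mono (by omega))⟩
    · obtain ⟨k, hk⟩ : ∃ k : ℕ, idx s = k + 1 := by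
        refine Nat.exists_eq_add_one.2 (Nat.pos_of_ne_zero fun h0 ↦ ?_)
        rw [h0] at heq
        exact absurd heq (ne_of_gt hs).symm
      refine ⟨k, ?_, ?_⟩
      · calc t k < t (k + 1) := ht_mono (Nat.lt_succ_self k)
          _ = s := by rw [← hk]; exact heq
      · calc s < t (idx s + 1) := hidx_lt s
          _ = t (k + 2) := by rw [hk]
  -- BAND: a flat point off `W` after `t 0` is a hole-chart point of bounded depth and radius whose clock does not lead
  have hband : ∀ y : (Minkowski.backgroundOn U₀).domain, y.1 ∉ W → t 0 < y.1 0 →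
      ∃ (i : Fin N) (m : ℕ) (x : (Kerr.background (M i) (a i)).domain), Ψ i x = Ψ₀ y ∧ τ' m < x.1 0 ∧
        x.1 0 ≤ y.1 0 ∧ 100 * M i ≤ Kerr.radius (a i) x.1 ∧ Kerr.radius (a i) x.1 ≤ C₂ * ρl m + C₁ := by
    intro y hyW hy0
    obtain ⟨m, hm1, hm2⟩ := hwindow (y.1 0) hy0
    have hnear : ∃ i, ‖E4.spatial y.1 - ξ i (y.1 0)‖ ≤ ρl m := by
      by_contra h
      push Not at h
      exact hyW (hW2 y.1 m hm1 hm2 h)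
    obtain ⟨i, hi⟩ := hnear
    obtain ⟨x, hx, hx1, hx2⟩ := hloc m i y hm1 hi
    exact ⟨i, m, x, hx, hx1, hnl m i x y hx1.le hx2 hx,
      hndf i x y ((hτ'T m).trans_lt hx1) hx, hx2⟩
  -- GENERATORS: the package's certified slab at `τ₁ > t 0` lies in `J⁻` of the Statement-shaped slab
  have hgen : ∀ τ₁ : ℝ, t 0 < τ₁ →
      Ψ₀ '' (Minkowski.backgroundOn U₀).timeSlab τ₁ ∪
          ⋃ i, Ψ i '' (Kerr.background (M i) (a i)).truncTimeSlab (2 * ρ₀) τ₁ ⊆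
        𝒟.toSpacetime.metric.causalPast 𝒟.toSpacetime.timeOrientation
          (Φ₀ '' (Minkowski.backgroundOn (U₀ ⊓ W)).timeSlab τ₁ ∪
            ⋃ i, Ψ i '' (Kerr.background (M i) (a i)).truncTimeSlab (R i τ₁) τ₁) := by
    intro τ₁ hτ₁ c hc
    rcases hc with ⟨y, hy, rfl⟩ | hc
    · have hyτ : y.1 0 = τ₁ := hy
      by_cases hyW : y.1 ∈ W
      · refine hsubJ _ (Or.inl ⟨⟨y.1, y.2, hyW⟩, hyτ, ?_⟩)
        rw [hΦval]
      · obtain ⟨i, m, x, hx, h1, h2, h3, h4⟩ := hband y hyW (hyτ ▸ hτ₁)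
        have h := hHov m i x τ₁ h1 (h2.trans_eq hyτ) h3 h4
        rw [hx] at h
        exact hJmono (subset_union_right.trans' (subset_iUnion _ i)) h
    · obtain ⟨i, hi⟩ := mem_iUnion.1 hc
      obtain ⟨x, ⟨hx1, hx2⟩, rfl⟩ := hi
      refine hsubJ _ (Or.inr (mem_iUnion.2 ⟨i, x, ⟨hx1, hx2.trans (hR2 i τ₁)⟩, rfl⟩))
  -- (S6) Statement-shaped exhaustion at every level `τ₁ > t 0`
  have hS6 : ∀ τ₁ : ℝ, t 0 < τ₁ →
      O \ (Φ₀ '' (Minkowski.backgroundOn (U₀ ⊓ W)).lateRegion τ₁ ∪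
          ⋃ i, Ψ i '' {x : (Kerr.background (M i) (a i)).domain |
            τ₁ < (Kerr.background (M i) (a i)).time x.1 ∧
              (Kerr.background (M i) (a i)).radius x.1 ≤ R i ((Kerr.background (M i) (a i)).time x.1)}) ⊆
        𝒟.toSpacetime.metric.causalPast 𝒟.toSpacetime.timeOrientation
          (Φ₀ '' (Minkowski.backgroundOn (U₀ ⊓ W)).timeSlab τ₁ ∪
            ⋃ i, Ψ i '' (Kerr.background (M i) (a i)).truncTimeSlab (R i τ₁) τ₁) := by
    rintro τ₁ hτ₁ q ⟨hqO, hqnot⟩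
    by_cases hb : q ∈ Ψ₀ '' (Minkowski.backgroundOn U₀).lateRegion τ₁
    · -- flat-late for the package: in `Φ₀`'s late image, or a band point (certified, or hovering)
      obtain ⟨y, hy, rfl⟩ := hb
      have hyτ : τ₁ < y.1 0 := hy
      by_cases hyW : y.1 ∈ W
      · exact (hqnot (Or.inl ⟨⟨y.1, y.2, hyW⟩, hyτ, by rw [hΦval]⟩)).elim
      · obtain ⟨i, m, x, hx, h1, h2, h3, h4⟩ := hband y hyW (hτ₁.trans hyτ)
        by_cases hxτ : τ₁ < x.1 0
        · refine (hqnot (Or.inr (mem_iUnion.2 ⟨i, x, ⟨hxτ, ?_⟩, hx⟩))).elim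
          exact h4.trans (hRτ m i (x.1 0) h1.le)
        · push Not at hxτ
          have h := hHov m i x τ₁ h1 hxτ h3 h4
          rw [hx] at h
          exact hJmono (subset_union_right.trans' (subset_iUnion _ i)) h
    · by_cases hc : q ∈ ⋃ i, Ψ i '' (Kerr.background (M i) (a i)).truncLateRegion τ₁ (2 * ρ₀)
      · -- tube-late for the package: certified, since `2ρ₀ ≤ Rᵢ`
        obtain ⟨i, hi⟩ := mem_iUnion.1 hc
        obtain ⟨x, ⟨hx1, hx2⟩, rfl⟩ := hi
        exact (hqnot (Or.inr (mem_iUnion.2 ⟨i, x, ⟨hx1, hx2.trans (hR2 i _)⟩, rfl⟩))).elim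
      · -- package-non-exempt: (EX) at the same level, generators, `J⁻J⁻ = J⁻`
        have h := hEX τ₁ ((hTt 0).trans hτ₁) ⟨hqO, fun h ↦ h.elim hb hc⟩
        rw [← hJJ]
        exact hJmono (hgen τ₁ hτ₁) h
  -- (O1) the region identity with the charts restarted at `t 0`
  -- every late flat point lies below the restarted charted region
  have hlev : ∀ p ∈ O, ∀ τ₂ : ℝ, t 0 < τ₂ → p ∉ Ψ₀ '' (Minkowski.backgroundOn U₀).lateRegion τ₂ →
      p ∈ 𝒟.toSpacetime.metric.causalPast 𝒟.toSpacetime.timeOrientation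
        (Φ₀ '' (Minkowski.backgroundOn (U₀ ⊓ W)).lateRegion (t 0) ∪
          ⋃ i, Ψ i '' (Kerr.background (M i) (a i)).lateRegion (t 0)) := by
    intro p hpO τ₂ hτ₂ hpf
    by_cases hc : p ∈ ⋃ i, Ψ i '' (Kerr.background (M i) (a i)).truncLateRegion τ₂ (2 * ρ₀)
    · obtain ⟨i, hi⟩ := mem_iUnion.1 hc
      obtain ⟨x, ⟨hx1, -⟩, rfl⟩ := hi
      exact hsubJ _ (Or.inr (mem_iUnion.2 ⟨i, x, lt_trans hτ₂ hx1, rfl⟩))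
    · have h := hEX τ₂ ((hTt 0).trans hτ₂) ⟨hpO, fun h ↦ h.elim hpf hc⟩
      have h' := hJmono (hgen τ₂ hτ₂) h
      rw [hJJ] at h'
      refine hJmono (union_subset_union (image_mono ?_) (iUnion_mono fun i ↦ image_mono ?_)) h'
      · exact (Minkowski.backgroundOn (U₀ ⊓ W)).timeSlab_subset_lateRegion hτ₂
      · exact ((Kerr.background (M i) (a i)).truncTimeSlab_subset_timeSlab _ _).trans
          ((Kerr.background (M i) (a i)).timeSlab_subset_lateRegion hτ₂)
  have hflatcase : ∀ y : (Minkowski.backgroundOn U₀).domain, T < y.1 0 →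
      Ψ₀ y ∈ 𝒟.toSpacetime.metric.causalPast 𝒟.toSpacetime.timeOrientation
        (Φ₀ '' (Minkowski.backgroundOn (U₀ ⊓ W)).lateRegion (t 0) ∪
          ⋃ i, Ψ i '' (Kerr.background (M i) (a i)).lateRegion (t 0)) := by
    intro y hyT
    refine hlev _ (hΨ₀.image_subset ⟨y, hyT, rfl⟩) (max (t 0) (y.1 0) + 1)
      ((le_max_left _ _).trans_lt (lt_add_one _)) ?_
    rintro ⟨y', hy', heq⟩
    have hy'τ : max (t 0) (y.1 0) + 1 < y'.1 0 := hy'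
    have hy'T : T < y'.1 0 :=
      (hTt 0).trans ((le_max_left _ _).trans_lt ((lt_add_one _).trans hy'τ))
    have hinj := hΨ₀.isOpenEmbedding.injective
      (a₁ := ⟨y', hy'T⟩) (a₂ := ⟨y, hyT⟩) (by simpa only [restrict_apply] using heq)
    have : y' = y := congrArg Subtype.val hinj
    rw [this] at hy'τ
    linarith [le_max_right (t 0) (y.1 0)]
  have hCTJ : Ψ₀ '' (Minkowski.backgroundOn U₀).lateRegion T ∪
        ⋃ i, Ψ i '' (Kerr.background (M i) (a i)).lateRegion T ⊆
      𝒟.toSpacetime.metric.causalPast 𝒟.toSpacetime.timeOrientation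
        (Φ₀ '' (Minkowski.backgroundOn (U₀ ⊓ W)).lateRegion (t 0) ∪
          ⋃ i, Ψ i '' (Kerr.background (M i) (a i)).lateRegion (t 0)) := by
    rintro p (⟨y, hy, rfl⟩ | hp)
    · exact hflatcase y hy
    · obtain ⟨i, hi⟩ := mem_iUnion.1 hp
      obtain ⟨x, hx, rfl⟩ := hi
      by_cases hpf : ∃ y : (Minkowski.backgroundOn U₀).domain, T < y.1 0 ∧ Ψ₀ y = Ψ i x
      · obtain ⟨y, hyT, hyeq⟩ := hpf
        rw [← hyeq]
        exact hflatcase y hyT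
      · refine hlev _ ((hΨ i).image_subset ⟨x, hx, rfl⟩) (t 0 + 1) (lt_add_one _) ?_
        rintro ⟨y', hy', heq⟩
        have hy'τ : t 0 + 1 < y'.1 0 := hy'
        exact hpf ⟨y', (hTt 0).trans ((lt_add_one _).trans hy'τ), heq⟩
  have hC'T : Φ₀ '' (Minkowski.backgroundOn (U₀ ⊓ W)).lateRegion (t 0) ∪
        ⋃ i, Ψ i '' (Kerr.background (M i) (a i)).lateRegion (t 0) ⊆
      Ψ₀ '' (Minkowski.backgroundOn U₀).lateRegion T ∪
        ⋃ i, Ψ i '' (Kerr.background (M i) (a i)).lateRegion T := by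
    refine union_subset_union ?_ (iUnion_mono fun i ↦ image_mono
      ((Kerr.background (M i) (a i)).lateRegion_mono (hTt 0).le))
    rintro _ ⟨y, hy, rfl⟩
    have hyt : t 0 < y.1 0 := hy
    exact ⟨⟨y.1, y.2.1⟩, (hTt 0).trans hyt, by rw [hΦval]⟩
  refine ⟨?_, hS6⟩
  refine Subset.antisymm (fun p hp ↦ ?_) fun p hp ↦ ?_
  · rw [hO] at hp
    refine ⟨hp.1, ?_⟩
    have h2 := LorentzianMetric.chronologicalFuture_mono (τ := 𝒟.timeOrientation.reverse) hCTJ hp.2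
    exact (LorentzianMetric.chronologicalFuture_causalFuture_eq_of_boundaryless
      (τ := 𝒟.timeOrientation.reverse) (WithTop.coe_le_coe.2 le_top) _).subset h2
  · rw [hO]
    exact ⟨hp.1, LorentzianMetric.chronologicalFuture_mono (τ := 𝒟.timeOrientation.reverse) hC'T hp.2⟩

end Summit.FinalStateConjecture.FinalStateConjecture.Theorems.DissipativeFinalMotions.DispersingCapture

end
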